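import Literature.AlgebraicGeometry.Motives.CechComplexPseudoCoherentDescent
import Literature.AlgebraicGeometry.Motives.CartierDivisorCechIndependence
import Literature.AlgebraicGeometry.Motives.CechComplexH0Fibre
import Literature.AlgebraicGeometry.Motives.SemicontinuityGrothendieckComplex
import HarnessLib

/-!
# The cohomological input of the Theorem of the Cube, one proper scheme at a time
# (Görtz–Wedhorn II, Thm. 23.133 / Cor. 23.135 for a FIXED `P → Spec K`)

The Theorem of the Cube (`theoremOfCube_linEquiv`, Görtz–Wedhorn II, Thm. 24.73) and everything
resting on it in this directory (`AbelianVariety.cubicalStructure_linEquiv`,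
`AbelianVariety.pullback_zsmul_id_linEquiv`, …) are proved in
`Motives/AbelianVarietyTheoremOfCubeProofs` from ONE named fact,
`cechComplex_pseudoCoherent_general` (`Motives/GrothendieckComplexSectionAlongCech`): for EVERY
proper `X → Spec K`, every `K`-scheme `T` with `X ×_K T` integral, every Cartier divisor `D` on
`X ×_K T`, every affine open `V ⊆ T` and every Čech cover `𝔚` of `pr_T⁻¹V` adapted to `D`, the
ordered Čech complex `Č•(𝔚, 𝒪(D))` of `Γ(V, 𝒪_T)`-modules is pseudo-coherent (Görtz–Wedhorn II,
Thm. 23.133 / Cor. 23.135: finiteness of the coherent cohomology of proper morphisms, via Chow's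
lemma and dévissage). All the implications of that chain are implications between GLOBAL
statements (`∀ K X T …`), although each of their printed proofs only ever uses the cohomological
input for the one proper scheme at hand — for the cube on `X ×_K Y ×_K T` the scheme
`P = X ×_K Y` (Görtz–Wedhorn II, proof of Thm. 24.73, p. 550: Thm. 24.66 and Lemma 24.72 are
applied to `f : X ×_S Y ×_S T → T`).

This file and its sequels (`Motives/CechPseudoCoherentAtGrauert`, `Motives/CechPseudoCoherentAtCube`)
re-thread that chain ONE PROPER SCHEME AT A TIME: the hypothesis is the restriction
`CechPseudoCoherentAt P` of the named fact to a fixed `P → Spec K`, and the conclusions are the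
pointwise statements of the chain for that `P`. The point: for a PROJECTIVE `P` (e.g. an abelian
variety, `AbelianVariety.isProjectiveOver_holds`, or a product of two, Segre) the hypothesis is
Serre's finiteness theorem for the line bundles `𝒪(D)` on the closed subschemes `P ×_K T₀` of
`𝐏ⁿ_{T₀}`, `T₀` affine noetherian (Görtz–Wedhorn II, Thm. 23.4; Hartshorne III Thm. 5.2), and
Chow's lemma is not needed. The proofs are those of the global chain, verbatim up to the
specialisation of the hypothesis; nothing new is claimed mathematically.

* `CechPseudoCoherentAt P` — the hypothesis; `cechPseudoCoherentAt_of_general` — it is implied by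
  the named fact;
* `CechPseudoCoherentAt.exists_perfect` — Steps (II)–(III) of the proof of Thm. 23.133 (p. 478):
  a perfect model `Q → Č•` in degrees `[0, r]` (as `cechComplex_perfect_of_general`);
* `cechPseudoCoherentAt_of_finiteType`, `cechPseudoCoherentAt_of_finite_cohomology`,
  `cechPseudoCoherentAt_of_exists_cechCover` — Step (IV) (noetherian approximation, p. 479) for a
  fixed `P` (as `cechComplex_pseudoCoherent_general_of_finiteType` /
  `…_of_finite_cohomology`, `Motives/CechComplexPseudoCoherentDescent`, whose proofs never change
  `P`), the last one combined with the cover independence of the finiteness of `Hⁿ(Č•(𝔚, 𝒪(D)))`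
  (`CartierDivisor.CechCover.module_finite_homology_iff`, `Motives/CartierDivisorCechIndependence`,
  Görtz–Wedhorn II, Thm. 22.9): **`CechPseudoCoherentAt P` follows from the finiteness of the Čech
  cohomology of `𝒪(D₀)` for ONE Čech cover of `P ×_K T₀`, for all affine integral `T₀` of finite
  type over `K` and all `D₀`** — the finiteness theorem (Thm. 23.17 / Thm. 23.4) for these sheaves;
* `CechPseudoCoherentAt.exists_matrix_sections_fibre` — the Grothendieck complex in degree `0` at
  the residue fields (`grothendieckComplex_h0`, Cor. 23.135 with (23.28.5)) for `X` with
  `CechPseudoCoherentAt X` (as `grothendieckComplex_h0_of_cech` with `cechComplex_h0_fibre_holds`);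
* `CechPseudoCoherentAt.isClosed_setOf_le_h0`, `CechPseudoCoherentAt.isClosed_sectionLocus`,
  `CechPseudoCoherentAt.isClosed_trivialLocus` — semicontinuity of `h⁰` (Thm. 23.139 (2)) and
  Thm. 24.66 (3) (closedness of the trivial locus) for such `X` (as
  `isClosed_setOf_le_h0_of_grothendieckComplex`, `seesaw_isClosed_trivialLocus_of_semicontinuity`).

No named facts are introduced (`CechPseudoCoherentAt P` is a hypothesis carried explicitly by every
theorem, never asserted). Mathlib searched (pin): no coherent cohomology, no finiteness theorem for
proper or projective morphisms (`Mathlib/AlgebraicGeometry` has `Proj`, `IsProper`; nothing on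
`Rf_*`).

## References

* U. Görtz, T. Wedhorn, *Algebraic Geometry II: Cohomology of Schemes*, Springer Spektrum (2023),
  doi:10.1007/978-3-658-43031-3: Thm. 22.9, p. 332; Thm. 23.133 and its proof, Steps (I)–(IV),
  pp. 478–479; Rem. 23.134, Cor. 23.135, Cor. 23.137, p. 480; (23.28.5), Thm. 23.139 (2), p. 482;
  Thm. 24.66 (3), proof, pp. 545–546; Thm. 24.73, proof, p. 550 (read via the held copy).
  [GortzWedhorn2023]
* D. Mumford, *Abelian Varieties*, TIFR Studies in Mathematics 5 (1970), §5. [MumfordAV1970]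
-/

universe u

open CategoryTheory CategoryTheory.Limits AlgebraicGeometry TopologicalSpace Opposite
open MonoidalCategory CartesianMonoidalCategory TensorProduct
open Literature.AlgebraicGeometry.Limits Literature.AlgebraicGeometry.Limits.SubalgApprox
open Literature.AlgebraicGeometry.Motives.RatFn Literature.Algebra.Homology

noncomputable section

namespace Literature.AlgebraicGeometry.Motives

set_option backward.isDefEq.respectTransparency false

variable {K : Type u} [Field K]

/-! ### The hypothesis -/

/-- **Pseudo-coherence of the Čech complexes of the line bundles `𝒪(D)` on `P ×_K T → T` for a
fixed proper `P → Spec K`**: for every `K`-scheme `T` with `P ×_K T` integral, every Cartier divisor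
`D` on `P ×_K T`, every affine open `V ⊆ T` and every Čech cover `𝔚` of `pr_T⁻¹V` adapted to `D`,
there are a bounded above complex `F` of finitely generated free `Γ(V, 𝒪_T)`-modules and a
quasi-isomorphism `F → Č•(𝔚, 𝒪(D)|_{pr_T⁻¹V})` — the statement of the named fact
`cechComplex_pseudoCoherent_general` (`Motives/GrothendieckComplexSectionAlongCech`; Görtz–Wedhorn
II, Thm. 23.133 / Cor. 23.135 with Prop. 21.162, Lemma 22.44, Thm. 21.78 (1), Thm. 22.9) for this
one `P`. A hypothesis of the theorems below, never asserted.
[cite: GortzWedhorn2023, Thm. 23.133 and Cor. 23.135 (pp. 478–480)] -/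
def CechPseudoCoherentAt (P : SchemeOver K) : Prop :=
  ∀ (T : SchemeOver K) [IsIntegral (P ⊗ T).left]
    (D : CartierDivisor (P ⊗ T).left) (V : T.left.Opens) (_ : IsAffineOpen V)
    (𝔚 : CartierDivisor.CechCover (snd P T).left V D),
    ∃ (F : CochainComplex (ModuleCat.{u} Γ(T.left, V)) ℤ) (φ : F ⟶ 𝔚.complex) (N : ℤ),
      QuasiIso φ ∧ F.IsStrictlyLE N ∧
        ∀ n, Module.Finite Γ(T.left, V) (F.X n) ∧ Module.Free Γ(T.left, V) (F.X n)

/-- The named fact `cechComplex_pseudoCoherent_general` is `CechPseudoCoherentAt P` for all proper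
`P`. [folklore] -/
theorem cechPseudoCoherentAt_of_general (h : cechComplex_pseudoCoherent_general.{u})
    (P : SchemeOver K) [IsProper P.hom] : CechPseudoCoherentAt P :=
  fun T _ D V hV 𝔚 => h K P T D V hV 𝔚

namespace CechPseudoCoherentAt

/-- **Perfectness of the Čech complex from its pseudo-coherence, for a fixed `P`** (Görtz–Wedhorn
II, proof of Thm. 23.133, Steps (II)–(III), p. 478, and Rem. 23.134: the terms of `Č•` are flat over
`Γ(V, 𝒪_T)` and vanish outside `[0, r]`, so a bounded above finite free resolution is replaced by a
quasi-isomorphism from finitely generated projectives in degrees `[0, r]`,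
`Literature.Algebra.Homology.exists_strictlyPerfect_quasiIso_of_flat`). The proof of
`cechComplex_perfect_of_general` (`Motives/GrothendieckComplexSectionAlongCech`).
[cite: GortzWedhorn2023, Thm. 23.133, proof, Steps (II)–(III) and Rem. 23.134 (pp. 478–480)] -/
theorem exists_perfect {P : SchemeOver K} [IsProper P.hom] (hP : CechPseudoCoherentAt P)
    (T : SchemeOver K) [IsIntegral (P ⊗ T).left] (D : CartierDivisor (P ⊗ T).left)
    (V : T.left.Opens) (hV : IsAffineOpen V) (𝔚 : CartierDivisor.CechCover (snd P T).left V D) :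
    ∃ (Q : CochainComplex (ModuleCat.{u} Γ(T.left, V)) ℤ) (ψ : Q ⟶ 𝔚.complex),
      QuasiIso ψ ∧ Q.IsStrictlyGE 0 ∧ Q.IsStrictlyLE 𝔚.r ∧
        ∀ n, Module.Finite Γ(T.left, V) (Q.X n) ∧ Module.Projective Γ(T.left, V) (Q.X n) := by
  obtain ⟨F, φ, N, hφ, hN, hF⟩ := hP T D V hV 𝔚
  haveI := hφ
  haveI := hN
  haveI : 𝔚.complex.IsStrictlyLE 𝔚.r := 𝔚.isStrictlyLE_complex
  haveI : 𝔚.complex.IsStrictlyGE 0 := 𝔚.isStrictlyGE_complex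
  haveI := flat_snd_left P T
  haveI := isSeparated_snd_left P T
  obtain ⟨Q, ψ, hψ, hGE, hLE, hQ⟩ :=
    Literature.Algebra.Homology.exists_strictlyPerfect_quasiIso_of_flat 𝔚.complex 𝔚.r
      (fun n => 𝔚.flat_complex_X hV n) F N
      (fun n => ⟨(hF n).1, by haveI := (hF n).2; infer_instance⟩) φ
  exact ⟨Q, ψ, hψ, hGE, hLE, hQ⟩

end CechPseudoCoherentAt

/-! ### Step (IV): reduction to a base of finite type over `K`, for a fixed `P` -/

/-- **`CechPseudoCoherentAt P` follows from its case over affine integral bases of finite type over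
`K`** (Görtz–Wedhorn II, Thm. 23.133, proof, Step (IV), p. 479, noetherian approximation): the proof
of `cechComplex_pseudoCoherent_general_of_finiteType` (`Motives/CechComplexPseudoCoherentDescent`),
which never changes `P` — `B = Γ(V, 𝒪_V)` is a domain, `(P ⊗ Spec B).left ≅ pr_T⁻¹V`, the cover and
the local equations of `D` descend to a stage `Spec K[t]` of finite type over `K`
(`CechCover.stageDivisor`, `stageCover`), and a finite free resolution ascends along
`K[t] → Γ(V, 𝒪_T)` (`OrderedCech.exists_finiteFree_quasiIso_of_baseChange`).
[cite: GortzWedhorn2023, Thm. 23.133, proof, Step (IV) (p. 479), with Cor. 23.135 (p. 480)] -/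
theorem cechPseudoCoherentAt_of_finiteType (P : SchemeOver K) [IsProper P.hom]
    (h : ∀ (T : SchemeOver K) [IsAffine T.left] [IsIntegral T.left] [LocallyOfFiniteType T.hom]
      [IsNoetherianRing Γ(T.left, ⊤)] [IsIntegral (P ⊗ T).left] (D : CartierDivisor (P ⊗ T).left)
      (𝔚 : CartierDivisor.CechCover (snd P T).left ⊤ D),
      ∃ (F : CochainComplex (ModuleCat.{u} Γ(T.left, ⊤)) ℤ) (φ : F ⟶ 𝔚.complex) (N : ℤ),
        QuasiIso φ ∧ F.IsStrictlyLE N ∧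
          ∀ n, Module.Finite Γ(T.left, ⊤) (F.X n) ∧ Module.Free Γ(T.left, ⊤) (F.X n)) :
    CechPseudoCoherentAt P := by
  intro T _ D V hV 𝔚
  haveI : IsIntegral (P ⊗ specOver K Γ(↑V, ⊤)).left := isIntegral_prodCone_pt P T V hV 𝔚.genericPoint_mem
  haveI : IsDomain Γ(↑V, ⊤) := isDomain_sections P T V hV 𝔚.genericPoint_mem
  haveI : ∀ t, IsIntegral ((prodDiagram K Γ(↑V, ⊤) (∅ : Finset Γ(↑V, ⊤)) P).obj t) :=
    isIntegral_prodDiagram_obj_of_isIntegral P T V hV 𝔚.genericPoint_mem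
  letI := CartierDivisor.baseAlgebra (snd P (𝔚.stageBase hV)).left ⊤ (𝔚.stageCover hV).genericPoint_mem
  letI := CartierDivisor.baseAlgebra (snd P T).left V 𝔚.genericPoint_mem
  have hflat : ∀ s : Finset (Fin (𝔚.r + 1)), s.Nonempty →
      Module.Flat Γ((𝔚.stageBase hV).left, ⊤) ((𝔚.stageCover hV).sectionsOn s) := fun s hs => by
    haveI := flat_snd_left P (𝔚.stageBase hV)
    haveI := isSeparated_snd_left P (𝔚.stageBase hV)
    exact (𝔚.stageCover hV).flat_sectionsOn (isAffineOpen_top _) hs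
  haveI : IsNoetherianRing Γ((𝔚.stageBase hV).left, ⊤) :=
    IsLocallyNoetherian.component_noetherian
      (⟨⊤, isAffineOpen_top _⟩ : (𝔚.stageBase hV).left.affineOpens)
  have h₀ := h (𝔚.stageBase hV) (𝔚.stageDivisor hV) (𝔚.stageCover hV)
  exact OrderedCech.exists_finiteFree_quasiIso_of_baseChange (𝔚.stageRingHom hV) (𝔚.stageΘₛₗ hV)
    (𝔚.stageΘₛₗ_mem hV) (𝔚.stageCover hV).sectionsOn_mono 𝔚.sectionsOn_mono hflat
    (𝔚.baseChangeMap_bijective hV) h₀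

/-- **`CechPseudoCoherentAt P` from the finiteness of the Čech cohomology of `𝒪(D₀)` on
`P ×_K T₀ → T₀` over affine integral bases `T₀` of finite type over `K`** (the finiteness theorem
for the coherent cohomology of the proper `P ×_K T₀ → T₀`, Görtz–Wedhorn II, Thm. 23.17 /
Prop. 23.23, i.e. Steps (I)–(III) of the proof of Thm. 23.133, for the sheaves `𝒪(D₀)` in Čech form),
for ALL Čech covers over `T₀`: over the noetherian `Γ(T₀, 𝒪)` a bounded above complex with finitely
generated cohomology has a finite free resolution
(`Literature.Algebra.Homology.exists_finiteFree_quasiIso_of_finite_homology`, Prop. 21.162 /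
Cor. 22.62), then `cechPseudoCoherentAt_of_finiteType`. The proof of
`cechComplex_pseudoCoherent_general_of_finite_cohomology` for one `P`.
[cite: GortzWedhorn2023, Thm. 23.133, proof, Steps (I)–(IV) (pp. 478–479), with Thm. 23.17 (p. 444), Prop. 21.162 (p. 311), Cor. 22.62 (p. 365)] -/
theorem cechPseudoCoherentAt_of_finite_cohomology (P : SchemeOver K) [IsProper P.hom]
    (h : ∀ (T : SchemeOver K) [IsAffine T.left] [IsIntegral T.left] [LocallyOfFiniteType T.hom]
      [IsNoetherianRing Γ(T.left, ⊤)] [IsIntegral (P ⊗ T).left] (D : CartierDivisor (P ⊗ T).left)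
      (𝔚 : CartierDivisor.CechCover (snd P T).left ⊤ D) (n : ℤ),
      Module.Finite Γ(T.left, ⊤) (𝔚.complex.homology n)) :
    CechPseudoCoherentAt P := by
  refine cechPseudoCoherentAt_of_finiteType P fun T _ _ _ _ _ D 𝔚 => ?_
  haveI := 𝔚.isStrictlyLE_complex
  obtain ⟨F, φ, hφ, hF, hfin⟩ := exists_finiteFree_quasiIso_of_finite_homology 𝔚.complex (𝔚.r : ℤ)
    (h T D 𝔚)
  exact ⟨F, φ, 𝔚.r, hφ, hF, hfin⟩

/-- **`CechPseudoCoherentAt P` from the finiteness of the Čech cohomology of `𝒪(D₀)` for ONE Čech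
cover of each `P ×_K T₀` over `T₀`** (`T₀` affine integral of finite type over `K`, `D₀` any Cartier
divisor on the integral `P ×_K T₀`): the finiteness of `Hⁿ(Č•(𝔚, 𝒪(D₀)))` does not depend on the
Čech cover (`CartierDivisor.CechCover.module_finite_homology_iff`,
`Motives/CartierDivisorCechIndependence`; Görtz–Wedhorn II, Thm. 22.9, `pr_{T₀}` being separated),
then `cechPseudoCoherentAt_of_finite_cohomology`. For `P` projective over `K` the hypothesis is
Serre's finiteness theorem for the sheaves `𝒪(D₀)` on the closed subscheme `P ×_K T₀` of
`𝐏ⁿ_{T₀}` computed on a convenient cover (Görtz–Wedhorn II, Thm. 23.4; Hartshorne III Thm. 5.2).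
[cite: GortzWedhorn2023, Thm. 22.9 (p. 332) and Thm. 23.133, proof (pp. 478–479)] -/
theorem cechPseudoCoherentAt_of_exists_cechCover (P : SchemeOver K) [IsProper P.hom]
    (h : ∀ (T : SchemeOver K) [IsAffine T.left] [IsIntegral T.left] [LocallyOfFiniteType T.hom]
      [IsNoetherianRing Γ(T.left, ⊤)] [IsIntegral (P ⊗ T).left] (D : CartierDivisor (P ⊗ T).left),
      ∃ 𝔚 : CartierDivisor.CechCover (snd P T).left ⊤ D,
        ∀ n : ℤ, Module.Finite Γ(T.left, ⊤) (𝔚.complex.homology n)) :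
    CechPseudoCoherentAt P := by
  refine cechPseudoCoherentAt_of_finite_cohomology P fun T _ _ _ _ _ D 𝔚 n => ?_
  obtain ⟨𝔚₀, h𝔚₀⟩ := h T D
  haveI := isSeparated_snd_left P T
  exact (CartierDivisor.CechCover.module_finite_homology_iff 𝔚 𝔚₀ (isAffineOpen_top _) n).2 (h𝔚₀ n)

/-! ### The Grothendieck complex in degree `0` at the residue fields, for a fixed `X` -/

namespace CechPseudoCoherentAt

variable {X : SchemeOver K} [IsProper X.hom] [GeometricallyIntegral X.hom]

/-- **Görtz–Wedhorn II, Cor. 23.135 with (23.28.5) in degree `0` for `𝒪(D)` on `X ×_K T → T`, for a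
fixed `X` with pseudo-coherent Čech complexes** (the statement of the named fact
`grothendieckComplex_h0` of `Motives/SemicontinuityGrothendieckComplex` at this `X`): every `t₀ ∈ T`
has an open neighbourhood `V` carrying a matrix `M` over `Γ(V, 𝒪_T)` with
`H⁰(X_t, 𝒪(D_t)) ≅ Ker M(t)` for all `t ∈ V`. The proof of `grothendieckComplex_h0_of_cech`
(`Motives/GrothendieckComplexCech`): around `t₀` an affine open `V` and a Čech cover `𝔚` of
`pr_T⁻¹V`; a perfect model `φ : Q → Č•` (`exists_perfect`); `H⁰(X_t, 𝒪(D_t)) ≅ Ker(d⁰_Č ⊗ κ(t))`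
(`cechComplex_h0_fibre_holds`) `≅ Ker(d⁰_Q ⊗ κ(t))` (`nonempty_ker_baseChange_equiv_of_quasiIso`);
and the matrix of `d⁰_Q` (`exists_matrix_chart_of_projective`).
[cite: GortzWedhorn2023, Cor. 23.135 and (23.28.5) (pp. 480–482)] -/
theorem exists_matrix_sections_fibre (hX : CechPseudoCoherentAt X) (T : SchemeOver K)
    [IsIntegral T.left] [IsIntegral (X ⊗ T).left] (D : CartierDivisor (X ⊗ T).left) (t₀ : T.left) :
    ∃ (V : T.left.Opens) (_ : t₀ ∈ V) (m n : ℕ) (M : Matrix (Fin n) (Fin m) Γ(T.left, V)),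
      ∀ (t : T.left) (ht : t ∈ V),
        letI := fibreOverResidueField X T t
        Nonempty (((D.classPullback (X ◁ residuePtι T t).left).sections (T.left.residueField t))
          ≃ₗ[T.left.residueField t]
            LinearMap.ker (M.map (T.left.evaluation V t ht).hom).mulVecLin) := by
  haveI : IsIntegral X.left := GeometricallyIntegral.isIntegral_of_subsingleton X.hom
  -- an affine open `V ∋ t₀` and a Čech cover of `pr_T⁻¹V`
  obtain ⟨V, hVaff, ht₀V, -⟩ := (Opens.isBasis_iff_nbhd.1 T.left.isBasis_affineOpens)
    (show t₀ ∈ (⊤ : T.left.Opens) from trivial)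
  have hξ := genericPoint_mem_preimage_snd X T ht₀V
  haveI := quasiCompact_snd_left X T
  obtain ⟨𝔚⟩ := CartierDivisor.CechCover.nonempty (snd X T).left V D hVaff hξ
  -- a perfect model of the Čech complex
  obtain ⟨P, φ, hφ, hGE, hLE, hfp⟩ := hX.exists_perfect T D V hVaff 𝔚
  haveI := hφ; haveI := hGE; haveI := hLE
  haveI := (hfp 0).1; haveI := (hfp 0).2; haveI := (hfp 1).1; haveI := (hfp 1).2
  -- the matrix of `d⁰_P : P⁰ → P¹` over `V`
  obtain ⟨m, n, M, hM⟩ := exists_matrix_chart_of_projective X T D V (P.d 0 1).hom fun t ht => by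
    letI := fibreOverResidueField X T t
    letI : Algebra Γ(T.left, V) (T.left.residueField t) := (T.left.evaluation V t ht).hom.toAlgebra
    obtain ⟨e₂⟩ := cechComplex_h0_fibre_holds K X T D V hVaff 𝔚 t ht
    obtain ⟨e₁⟩ := nonempty_ker_baseChange_equiv_of_quasiIso X T D hVaff 𝔚 φ
      (fun n => (hfp n).2) (T.left.residueField t) (T.left.evaluation V t ht).hom
    exact ⟨e₂.trans e₁.symm⟩
  exact ⟨V, ht₀V, m, n, M, hM⟩

/-! ### Semicontinuity of `h⁰` and closedness of the trivial locus, for a fixed `X` -/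

/-- Granted the Grothendieck complex at `X`, `t` lies in the section locus
`N(D) = {t ; H⁰(X_t, 𝒪(D_t)) ≠ 0}` iff `h⁰(X_t, 𝒪(D_t)) > 0` (Görtz–Wedhorn II, proof of
Thm. 24.66 (3): `{s ; dim H⁰(X_s, 𝓛_s) > 0}`). The proof of
`mem_sectionLocus_iff_h0_pos_of_grothendieckComplex`. [cite: GortzWedhorn2023, Thm. 24.66 (3), proof (pp. 545–546)] -/
theorem mem_sectionLocus_iff_h0_pos (hX : CechPseudoCoherentAt X) (T : SchemeOver K)
    [IsIntegral T.left] [IsIntegral (X ⊗ T).left] (D : CartierDivisor (X ⊗ T).left) (t : T.left) :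
    t ∈ CartierDivisor.sectionLocus X T D ↔
      letI := fibreOverResidueField X T t;
      0 < (D.classPullback (X ◁ residuePtι T t).left).h0 (T.left.residueField t) := by
  letI := fibreOverResidueField X T t
  obtain ⟨V, hV, m, n, M, hM⟩ := hX.exists_matrix_sections_fibre T D t
  obtain ⟨e⟩ := hM t hV
  haveI := Module.Finite.equiv e.symm
  rw [CartierDivisor.mem_sectionLocus_iff, CartierDivisor.h0, pos_iff_ne_zero, Ne,
    Submodule.finrank_eq_zero, Submodule.eq_bot_iff]
  simp only [CartierDivisor.mem_sections_iff, not_forall, exists_prop]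
  exact ⟨fun ⟨s, hs0, hs⟩ => ⟨s, hs, hs0⟩, fun ⟨s, hs, hs0⟩ => ⟨s, hs0, hs⟩⟩

/-- **Thm. 23.139 (2) for `i = 0` and every threshold `d`, for a fixed `X`** (Görtz–Wedhorn II,
Thm. 23.139 (2), proved on p. 466: `b⁰(s) = dim Ker(d⁰ ⊗ κ(s))` is upper semicontinuous): the set
`{t ∈ T ; h⁰(X_t, 𝒪(D_t)) ≥ d}` is closed. The proof of `isClosed_setOf_le_h0_of_grothendieckComplex`
(`Motives/SemicontinuityGrothendieckComplex`): near `t₀` with `h⁰(t₀) < d`, `h⁰(t) = m − rank M(t)`,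
some `(m + 1 − d)`-minor of `M` does not vanish at `t₀`, and on its basic open `h⁰ < d`.
[cite: GortzWedhorn2023, Thm. 23.139 (2) and Prop. 23.117, proof (pp. 466, 482–483)] -/
theorem isClosed_setOf_le_h0 (hX : CechPseudoCoherentAt X) (T : SchemeOver K)
    [IsIntegral T.left] [IsIntegral (X ⊗ T).left] (D : CartierDivisor (X ⊗ T).left) (d : ℕ) :
    IsClosed {t : T.left | letI := fibreOverResidueField X T t;
      d ≤ (D.classPullback (X ◁ residuePtι T t).left).h0 (T.left.residueField t)} := by
  classical
  rw [← isOpen_compl_iff, isOpen_iff_forall_mem_open]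
  intro t₀ ht₀
  obtain ⟨V, hV, m, n, M, hM⟩ := hX.exists_matrix_sections_fibre T D t₀
  -- on `V`: `h⁰(t) < d` iff `rank M(t) ≥ m + 1 - d` (rank–nullity)
  have key : ∀ (t : T.left) (ht : t ∈ V),
      t ∈ {t : T.left | letI := fibreOverResidueField X T t;
        d ≤ (D.classPullback (X ◁ residuePtι T t).left).h0 (T.left.residueField t)}ᶜ ↔
      m + 1 - d ≤ (M.map (T.left.evaluation V t ht).hom).rank := by
    intro t ht
    obtain ⟨e⟩ := hM t ht
    have hrn := h0_add_rank_eq_of_equiv_ker X T D M t ht e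
    simp only [Set.mem_compl_iff, Set.mem_setOf_eq, not_le]
    omega
  -- a minor of that size which does not vanish at `t₀`
  obtain ⟨r, c, hrc⟩ :=
    (_root_.Literature.LinearAlgebra.Matrix.le_rank_iff_exists_det_submatrix_ne_zero _).1
      ((key t₀ hV).1 ht₀)
  set μ : Γ(T.left, V) := (M.submatrix r c).det with hμdef
  have hμ : ∀ (t : T.left) (ht : t ∈ V), (T.left.evaluation V t ht).hom μ =
      ((M.map (T.left.evaluation V t ht).hom).submatrix r c).det := fun t ht => by
    rw [hμdef, RingHom.map_det, RingHom.mapMatrix_apply, Matrix.submatrix_map]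
  refine ⟨T.left.basicOpen μ, fun t ht => ?_, (T.left.basicOpen μ).isOpen, ?_⟩
  · -- on `T_μ` the rank stays `≥ m + 1 - d`
    have htV : t ∈ V := T.left.basicOpen_le μ ht
    have hne : (T.left.evaluation V t htV).hom μ ≠ 0 :=
      (T.left.evaluation_ne_zero_iff_mem_basicOpen t htV μ).mpr ht
    rw [hμ t htV] at hne
    exact (key t htV).2
      ((_root_.Literature.LinearAlgebra.Matrix.le_rank_iff_exists_det_submatrix_ne_zero _).2
        ⟨r, c, hne⟩)
  · -- `t₀ ∈ T_μ`
    refine (T.left.evaluation_ne_zero_iff_mem_basicOpen t₀ hV μ).mp ?_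
    rw [hμ t₀ hV]
    exact hrc

/-- **Thm. 23.139 (2) for `i = 0`, `n = 1`, for a fixed `X`**: the section locus
`N(D) = {t ; H⁰(X_t, 𝒪(D_t)) ≠ 0} = {t ; h⁰ ≥ 1}` is closed (the statement of the named fact
`semicontinuity_isClosed_sectionLocus` of `Motives/SeesawSemicontinuity` at this `X`).
[cite: GortzWedhorn2023, Thm. 23.139 (2) (p. 482)] -/
theorem isClosed_sectionLocus (hX : CechPseudoCoherentAt X) (T : SchemeOver K)
    [IsIntegral T.left] [IsIntegral (X ⊗ T).left] (D : CartierDivisor (X ⊗ T).left) :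
    IsClosed (CartierDivisor.sectionLocus X T D) := by
  have e : CartierDivisor.sectionLocus X T D = {t : T.left | letI := fibreOverResidueField X T t;
      1 ≤ (D.classPullback (X ◁ residuePtι T t).left).h0 (T.left.residueField t)} :=
    Set.ext fun t => hX.mem_sectionLocus_iff_h0_pos T D t
  rw [e]
  exact hX.isClosed_setOf_le_h0 T D 1

/-- **Thm. 24.66 (3) (closedness of the trivial locus `Z = {t ; 𝒪(D)|_{X_t} trivial}`) for a fixed
`X` with pseudo-coherent Čech complexes** (the statement of the named fact
`seesaw_isClosed_trivialLocus` of `Motives/SeesawTheorem` at this `X`): `Z = N(D) ∩ N(-D)`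
(`CartierDivisor.trivialLocus_eq_sectionLocus_inter`, Lemma 24.65 fibrewise) is closed by the
semicontinuity just proved — the proof of `seesaw_isClosed_trivialLocus_of_semicontinuity`.
[cite: GortzWedhorn2023, Thm. 24.66 (3), proof (pp. 545–546)] -/
theorem isClosed_trivialLocus (hX : CechPseudoCoherentAt X) (T : SchemeOver K)
    [IsIntegral T.left] [IsIntegral (X ⊗ T).left] (D : CartierDivisor (X ⊗ T).left) :
    IsClosed (CartierDivisor.trivialLocus X T D) := by
  rw [CartierDivisor.trivialLocus_eq_sectionLocus_inter]
  exact (hX.isClosed_sectionLocus T D).inter (hX.isClosed_sectionLocus T (-D))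

end CechPseudoCoherentAt

end Literature.AlgebraicGeometry.Motives

end
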